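import Literature.NumberTheory.EllipticCurves.ZpExtensionGaloisTwist
import Literature.NumberTheory.EllipticCurves.H1CorestrictionIndexTwo
import Literature.NumberTheory.GaloisRepresentations.CohomologicalDimension
import HarnessLib

/-!
# The unit twist `A(χ_u)` of a `p`-primary discrete Galois module at INFINITE level

Greenberg, *Iwasawa theory for elliptic curves* (LNM 1716), §4 p. 105: for a discrete `p`-primary
`Γ_K`-module `A` (there `A = E[p^∞]`), a `ℤ_p`-extension `κ : Γ_K ↠ ℤ_p` and `s ∈ ℤ_p` one forms
`A_s = A ⊗ κ^s`, the same group with the Galois action multiplied by the character `κ^s`; p. 107: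
«as `G_{F_∞}`-modules `A_s = A`», so `H¹(F_∞, A_s) = H¹(F_∞, A)` with the action of `Γ = ⟨γ⟩` twisted.

Here the character is `χ_u(σ) = u^{κ(σ)}` for an integer `u ≡ 1 (mod p)` (so `u^{κ(σ)}` makes sense on
every `p^k`-torsion element through `κ(σ) mod p^k`, file `IwasawaTwistModP`'s `twistExponent`); the
companion file `ZpExtensionGaloisTwist` (t42) treats the FINITE levels `M[p^J](χ_u)` as bundled
`DiscreteGaloisModule`s. This file provides the infinite level as a TYPE SYNONYM
`κ.UnitTwist M hM u hu` carrying the twisted `DistribMulAction (absoluteGaloisGroup K)` INSTANCE, so that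
the tree's instance-based cohomology (`subgroupH1`, `conjH1`, the procyclic-descent engines) applies to
`A(χ_u)` verbatim, together with:

* `UnitTwist.ofTwist_smul…` — the action is `σ ⋆ a = u^{κ(σ) mod p^k} · σ a` for ANY `k` with `p^k a = 0`;
  `ker κ` acts as on `A`; a topological generator `γ` acts by `u · γ`;
* `UnitTwist.isOpen_stabilizer`, `UnitTwist.isPrimaryTorsion` — `A(χ_u)` is again a discrete
  `p`-primary module (inputs of `LocBridge.ofSMul` / `ProcyclicDescent`);
* `subgroupH1Congr` — `H¹(H, A(χ_u)) ≃ H¹(H, A)` for every `H ≤ ker κ` (generic: `H¹` along an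
  `H`-equivariant additive isomorphism of coefficients), and `subgroupH1Congr_conjH1_eq_zsmul` — under it
  `conj_σ` on `H¹(H, A(χ_u))` is `u^{κ(σ)} · conj_σ` on `H¹(H, A)` (Greenberg p. 107).

References: R. Greenberg, LNM 1716 (1999), §4 pp. 105–107 [GreenbergLNM1716]; J.-P. Serre, *Galois
Cohomology* (1997), I §2.1, I §5.3 (twisting) [SerreGaloisCohomology1997]; L. Washington, *Introduction to
Cyclotomic Fields* (1997), §13.1 [Washington1997].
-/

noncomputable section

open Field Topology
open scoped Pointwise

universe u

namespace Literature.NumberTheory.EllipticCurves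

open Literature.NumberTheory.GaloisRepresentations

namespace ZpExtension

/-! ## §1. Element-level torsion arithmetic: `u^a · m` depends on `a` only modulo `p^J` if `p^J m = 0` -/

section Torsion

variable {p : ℕ} {M : Type*} [AddCommGroup M] {J : ℕ} {m : M}

/-- If `p ∣ u − 1` and `p^J · m = 0` then `u^{p^J} · m = m` (`p^{J+1} ∣ u^{p^J} − 1`,
Mathlib `dvd_sub_pow_of_dvd_sub`); element-level form of t42's `pow_prime_pow_zsmul_eq`.
[cite: Washington1997, §13.1–§13.2] -/
theorem pow_prime_pow_zsmul_eq_of_nsmul_eq_zero (hm : p ^ J • m = 0) {u : ℤ}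
    (hu : (p : ℤ) ∣ u - 1) : (u ^ p ^ J) • m = m := by
  obtain ⟨c, hc⟩ : ((p : ℤ) ^ J) ∣ u ^ p ^ J - 1 := by
    have h := dvd_sub_pow_of_dvd_sub (R := ℤ) (p := p) (a := u) (b := 1) hu J
    rw [one_pow] at h
    exact (pow_dvd_pow (p : ℤ) (Nat.le_succ J)).trans h
  have h0 : (u ^ p ^ J - 1) • m = 0 := by
    rw [hc, mul_comm, mul_smul, ← Nat.cast_pow, natCast_zsmul, hm, smul_zero]
  rwa [sub_smul, one_smul, sub_eq_zero] at h0

/-- Hence `(u^{p^J})^k · m = m`. [cite: Washington1997, §13.1–§13.2] -/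
theorem pow_prime_pow_pow_zsmul_eq_of_nsmul_eq_zero (hm : p ^ J • m = 0) {u : ℤ}
    (hu : (p : ℤ) ∣ u - 1) (k : ℕ) : ((u ^ p ^ J) ^ k) • m = m := by
  induction k with
  | zero => rw [pow_zero, one_smul]
  | succ k ih => rw [pow_succ, mul_smul, pow_prime_pow_zsmul_eq_of_nsmul_eq_zero hm hu, ih]

/-- So `u^a · m` depends on `a` only modulo `p^J`: `u^{a mod p^J} · m = u^a · m`.
[cite: Washington1997, §13.1–§13.2] -/
theorem pow_mod_zsmul_eq_of_nsmul_eq_zero (hm : p ^ J • m = 0) {u : ℤ} (hu : (p : ℤ) ∣ u - 1)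
    (a : ℕ) : (u ^ (a % p ^ J)) • m = (u ^ a) • m := by
  conv_rhs => rw [← Nat.mod_add_div a (p ^ J), pow_add, pow_mul, mul_smul,
    pow_prime_pow_pow_zsmul_eq_of_nsmul_eq_zero hm hu]

/-- A finite set of elements of a `p`-primary torsion group is killed by a common power of `p`.
[cite: SerreGaloisCohomology1997, I §3.1] -/
theorem exists_pow_nsmul_eq_zero_of_finite (hM : IsPrimaryTorsion p M) {S : Set M} (hS : S.Finite) :
    ∃ L : ℕ, ∀ v ∈ S, p ^ L • v = 0 := by
  classical
  choose r hr using hM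
  refine ⟨hS.toFinset.sup r, fun v hv ↦ ?_⟩
  have hle : r v ≤ hS.toFinset.sup r := Finset.le_sup (hS.mem_toFinset.mpr hv)
  rw [← Nat.sub_add_cancel hle, pow_add, mul_smul, hr, smul_zero]

end Torsion

variable {K : Type u} [Field K] {p : ℕ} [Fact p.Prime] (κ : ZpExtension K p)

/-! ## §2. The exponent `κ(σ) mod p^k` is compatible between levels -/

/-- `(κ σ mod p^m) mod p^n = κ σ mod p^n` for `n ≤ m` (`PadicInt.zmod_cast_comp_toZModPow`).
[cite: Washington1997, §13.1] -/
theorem twistExponent_mod_pow_of_le {n m : ℕ} (h : n ≤ m) (σ : absoluteGaloisGroup K) :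
    κ.twistExponent m σ % p ^ n = κ.twistExponent n σ := by
  haveI : NeZero (p ^ m) := ⟨pow_ne_zero _ (Fact.out : p.Prime).ne_zero⟩
  unfold twistExponent
  conv_rhs => rw [← PadicInt.zmod_cast_comp_toZModPow n m h, RingHom.comp_apply, ZMod.castHom_apply,
    ZMod.cast_eq_val, ZMod.val_natCast]

/-- **Level independence of the twisting scalar**: `u^{κ σ mod p^k} · a = u^{κ σ mod p^{k'}} · a` whenever
`p^k a = 0 = p^{k'} a` (both equal `u^{κ σ mod p^{k+k'}} · a`). [cite: GreenbergLNM1716, §4 p. 105] -/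
theorem pow_twistExponent_zsmul_eq {M : Type*} [AddCommGroup M] {u : ℤ} (hu : (p : ℤ) ∣ u - 1)
    {a : M} {k k' : ℕ} (hk : p ^ k • a = 0) (hk' : p ^ k' • a = 0) (σ : absoluteGaloisGroup K) :
    (u ^ κ.twistExponent k σ) • a = (u ^ κ.twistExponent k' σ) • a := by
  rw [← κ.twistExponent_mod_pow_of_le (Nat.le_add_right k k') σ,
    pow_mod_zsmul_eq_of_nsmul_eq_zero hk hu, ← κ.twistExponent_mod_pow_of_le (Nat.le_add_left k' k) σ,
    pow_mod_zsmul_eq_of_nsmul_eq_zero hk' hu]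

/-! ## §3. The type synonym `A(χ_u)` and its twisted Galois action -/

/-- **`A(χ_u)` — the unit twist of a `p`-primary `Γ_K`-module `A` at infinite level** (Greenberg's
`A_s = A ⊗ κ^s`, LNM 1716 §4 p. 105, with `κ^s` replaced by `χ_u = u^{κ}`, `u ≡ 1 mod p`): the type `A`
itself; it receives below the discrete topology and the TWISTED action
`σ ⋆ a = u^{κ(σ) mod p^{k(a)}} · σ a` (`p^{k(a)} a = 0`). The arguments `κ`, `hM`, `hu` only index the
synonym. [cite: GreenbergLNM1716, §4 p. 105] -/
@[nolint unusedArguments]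
def UnitTwist (_κ : ZpExtension K p) (M : Type u) [AddCommGroup M]
    [DistribMulAction (absoluteGaloisGroup K) M] (_hM : IsPrimaryTorsion p M) (u : ℤ)
    (_hu : (p : ℤ) ∣ u - 1) : Type u :=
  M

namespace UnitTwist

variable {κ} {M : Type u} [AddCommGroup M] [DistribMulAction (absoluteGaloisGroup K) M]
  {hM : IsPrimaryTorsion p M} {u : ℤ} {hu : (p : ℤ) ∣ u - 1}

/-- `A(χ_u)` is an abelian group (the group `A`). [cite: GreenbergLNM1716, §4 p. 105] -/
instance instAddCommGroup : AddCommGroup (κ.UnitTwist M hM u hu) := inferInstanceAs (AddCommGroup M)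

/-- `A(χ_u)` carries the discrete topology. [cite: SerreGaloisCohomology1997, I §2.1] -/
instance instTopologicalSpace : TopologicalSpace (κ.UnitTwist M hM u hu) := ⊥

/-- `A(χ_u)` is discrete. [cite: SerreGaloisCohomology1997, I §2.1] -/
instance instDiscreteTopology : DiscreteTopology (κ.UnitTwist M hM u hu) := ⟨rfl⟩

/-- The identity `A(χ_u) ≃ A` of underlying groups («as `G_{F_∞}`-modules, `A_s = A`»).
[cite: GreenbergLNM1716, §4 p. 107] -/
def ofTwist : κ.UnitTwist M hM u hu ≃+ M := AddEquiv.refl M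

/-- The identity `A ≃ A(χ_u)` of underlying groups. [cite: GreenbergLNM1716, §4 p. 107] -/
def toTwist : M ≃+ κ.UnitTwist M hM u hu := AddEquiv.refl M

/-- `ofTwist ∘ toTwist = id` («`A_s = A` as groups»). [cite: GreenbergLNM1716, §4 p. 107] -/
@[simp] theorem ofTwist_toTwist (m : M) : ofTwist (toTwist m : κ.UnitTwist M hM u hu) = m := rfl

/-- `toTwist ∘ ofTwist = id` («`A_s = A` as groups»). [cite: GreenbergLNM1716, §4 p. 107] -/
@[simp] theorem toTwist_ofTwist (t : κ.UnitTwist M hM u hu) : (toTwist (ofTwist t) : κ.UnitTwist M hM u hu) = t :=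
  rfl

variable (hM) in
/-- A chosen exponent `k(a)` with `p^{k(a)} a = 0` (`A` is `p`-primary). [cite: SerreGaloisCohomology1997, I §3.1] -/
def level (a : M) : ℕ := Classical.choose (hM a)

variable (hM) in
omit [Fact p.Prime] in
/-- `p^{k(a)} a = 0`. [cite: SerreGaloisCohomology1997, I §3.1] -/
theorem level_spec (a : M) : p ^ level hM a • a = 0 := Classical.choose_spec (hM a)

/-- **The twisted action** `σ ⋆ a = u^{κ(σ) mod p^{k(a)}} · σ a` of `Γ_K` on `A(χ_u)`.
[cite: GreenbergLNM1716, §4 p. 105] -/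
instance instSMul : SMul (absoluteGaloisGroup K) (κ.UnitTwist M hM u hu) :=
  ⟨fun σ t ↦ toTwist ((u ^ κ.twistExponent (level hM (ofTwist t)) σ) • (σ • ofTwist t))⟩

/-- Unfolding the twisted action at the chosen exponent. [cite: GreenbergLNM1716, §4 p. 105] -/
theorem ofTwist_smul (σ : absoluteGaloisGroup K) (t : κ.UnitTwist M hM u hu) :
    ofTwist (σ • t) = (u ^ κ.twistExponent (level hM (ofTwist t)) σ) • (σ • ofTwist t) := rfl

/-- `p^{k(a)}` kills `σ a` (the Galois action preserves `p^k`-torsion). [cite: SerreGaloisCohomology1997, I §3.1] -/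
theorem pow_level_nsmul_smul_ofTwist (σ : absoluteGaloisGroup K) (t : κ.UnitTwist M hM u hu) :
    p ^ level hM (ofTwist t) • (σ • ofTwist t) = 0 := by
  rw [← smul_comm σ (p ^ level hM (ofTwist t)) (ofTwist t), level_spec, smul_zero]

/-- **The twisted action at ANY killing exponent**: `σ ⋆ a = u^{κ(σ) mod p^k} · σ a` whenever `p^k a = 0`
(independence of the chosen exponent, `pow_twistExponent_zsmul_eq`). [cite: GreenbergLNM1716, §4 p. 105] -/
theorem ofTwist_smul_of_nsmul_eq_zero (σ : absoluteGaloisGroup K) {t : κ.UnitTwist M hM u hu} {k : ℕ}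
    (hk : p ^ k • ofTwist t = 0) :
    ofTwist (σ • t) = (u ^ κ.twistExponent k σ) • (σ • ofTwist t) := by
  rw [ofTwist_smul]
  exact κ.pow_twistExponent_zsmul_eq hu (pow_level_nsmul_smul_ofTwist σ t)
    (by rw [← smul_comm σ (p ^ k) (ofTwist t), hk, smul_zero]) σ

/-- `p^{k(a)}` kills `τ ⋆ a` (the twisted action preserves `p^k`-torsion). [cite: GreenbergLNM1716, §4 p. 105] -/
theorem pow_level_nsmul_ofTwist_smul (τ : absoluteGaloisGroup K) (t : κ.UnitTwist M hM u hu) :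
    p ^ level hM (ofTwist t) • ofTwist (τ • t) = 0 := by
  rw [ofTwist_smul, smul_comm, pow_level_nsmul_smul_ofTwist, smul_zero]

/-- **`A(χ_u)` is a `Γ_K`-set**: `1 ⋆ a = a` (`κ 1 = 0`) and `(στ) ⋆ a = σ ⋆ (τ ⋆ a)` (`κ` is a
homomorphism, the exponents add modulo `p^{k(a)}`, which acts trivially by §1, and `σ` commutes with the
integer scalar). [cite: GreenbergLNM1716, §4 p. 105] -/
instance instMulAction : MulAction (absoluteGaloisGroup K) (κ.UnitTwist M hM u hu) where
  one_smul t := by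
    apply ofTwist.injective
    rw [ofTwist_smul, twistExponent_one, pow_zero, one_smul, one_smul]
  mul_smul σ τ t := by
    apply ofTwist.injective
    rw [ofTwist_smul (σ * τ) t, twistExponent_mul,
      pow_mod_zsmul_eq_of_nsmul_eq_zero (pow_level_nsmul_smul_ofTwist (σ * τ) t) hu, pow_add,
      ← smul_smul, mul_smul σ τ (ofTwist t),
      ofTwist_smul_of_nsmul_eq_zero σ (pow_level_nsmul_ofTwist_smul τ t), ofTwist_smul τ t,
      smul_comm σ (u ^ κ.twistExponent (level hM (ofTwist t)) τ) (τ • ofTwist t)]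

/-- **`A(χ_u)` is a `Γ_K`-module** (the twisted action is additive: evaluate both summands at a common
killing exponent). [cite: GreenbergLNM1716, §4 p. 105] -/
instance instDistribMulAction : DistribMulAction (absoluteGaloisGroup K) (κ.UnitTwist M hM u hu) where
  smul_zero σ := by
    apply ofTwist.injective
    rw [ofTwist_smul, map_zero, smul_zero, smul_zero]
  smul_add σ s t := by
    apply ofTwist.injective
    have hs : p ^ (level hM (ofTwist s) + level hM (ofTwist t)) • ofTwist s = 0 := by
      rw [pow_add, mul_comm, mul_smul, level_spec, smul_zero]
    have ht : p ^ (level hM (ofTwist s) + level hM (ofTwist t)) • ofTwist t = 0 := by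
      rw [pow_add, mul_smul, level_spec, smul_zero]
    have hst : p ^ (level hM (ofTwist s) + level hM (ofTwist t)) • ofTwist (s + t) = 0 := by
      rw [map_add, smul_add, hs, ht, add_zero]
    rw [ofTwist_smul_of_nsmul_eq_zero σ hst, map_add, map_add, smul_add, smul_add,
      ofTwist_smul_of_nsmul_eq_zero σ hs, ofTwist_smul_of_nsmul_eq_zero σ ht]

/-! ## §4. `ker κ` acts plainly, `γ` acts by `u · γ`; discreteness; `p`-primarity -/

/-- **`Gal(K̄/K_∞) = ker κ` acts on `A(χ_u)` as on `A`** («as `G_{F_∞}`-modules, `A_s = A`»).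
[cite: GreenbergLNM1716, §4 p. 107] -/
theorem ofTwist_smul_of_mem_kerSubgroup {σ : absoluteGaloisGroup K} (hσ : σ ∈ κ.kerSubgroup)
    (t : κ.UnitTwist M hM u hu) : ofTwist (σ • t) = σ • ofTwist t := by
  rw [ofTwist_smul, κ.twistExponent_eq_zero_of_mem_kerSubgroup hσ, pow_zero, one_smul]

/-- `Gal(K̄/K_{k(a)})` acts on `a ∈ A(χ_u)` as on `A` (its exponent at level `k(a)` vanishes).
[cite: Washington1997, §13.1] -/
theorem ofTwist_smul_of_mem_layerSubgroup {σ : absoluteGaloisGroup K} {t : κ.UnitTwist M hM u hu}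
    (hσ : σ ∈ κ.layerSubgroup (level hM (ofTwist t))) : ofTwist (σ • t) = σ • ofTwist t := by
  rw [ofTwist_smul, κ.twistExponent_eq_zero_of_mem_layerSubgroup hσ, pow_zero, one_smul]

/-- **A topological generator `γ` of `κ` acts on `A(χ_u)` by `u · γ`** (`κ γ = 1`).
[cite: GreenbergLNM1716, §4 p. 107] -/
theorem ofTwist_smul_of_isTopGenerator {γ : absoluteGaloisGroup K} (hγ : κ.IsTopGenerator γ)
    (t : κ.UnitTwist M hM u hu) : ofTwist (γ • t) = u • (γ • ofTwist t) := by
  rcases Nat.eq_zero_or_pos (level hM (ofTwist t)) with h0 | hpos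
  · have ha : ofTwist t = 0 := by
      have h := level_spec hM (ofTwist t)
      rwa [h0, pow_zero, one_smul] at h
    rw [ofTwist_smul, ha, smul_zero, smul_zero, smul_zero]
  · rw [ofTwist_smul, κ.twistExponent_eq_one_of_isTopGenerator hpos hγ, pow_one]

/-- Natural multiples commute with `toTwist`/`ofTwist` («`A_s = A` as groups»). [cite: GreenbergLNM1716, §4 p. 107] -/
theorem ofTwist_nsmul (n : ℕ) (t : κ.UnitTwist M hM u hu) : ofTwist (n • t) = n • ofTwist t := rfl

/-- **`A(χ_u)` is `p`-primary torsion** (as a group it is `A`). [cite: GreenbergLNM1716, §4 p. 105] -/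
theorem isPrimaryTorsion : IsPrimaryTorsion p (κ.UnitTwist M hM u hu) := fun t ↦
  ⟨level hM (ofTwist t), ofTwist.injective (by rw [ofTwist_nsmul, level_spec, map_zero])⟩

/-- **The stabilisers of the twisted action are open** when those of `A` are: the stabiliser of `a` in
`A(χ_u)` is a subgroup containing the open subgroup `Stab_A(a) ∩ Gal(K̄/K_{k(a)})`. So `A(χ_u)` is a
discrete `Γ_K`-module in the sense of Serre. [cite: SerreGaloisCohomology1997, I §2.1]
[cite: GreenbergLNM1716, §4 p. 105] -/
theorem isOpen_stabilizer (hMo : ∀ m : M, IsOpen {σ : absoluteGaloisGroup K | σ • m = m})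
    (t : κ.UnitTwist M hM u hu) : IsOpen {σ : absoluteGaloisGroup K | σ • t = t} := by
  have h1 : {σ : absoluteGaloisGroup K | σ • t = t} =
      (MulAction.stabilizer (absoluteGaloisGroup K) t : Set (absoluteGaloisGroup K)) := by
    ext σ; simp [MulAction.mem_stabilizer_iff]
  rw [h1]
  apply Subgroup.isOpen_of_mem_nhds _ (g := 1)
  have hU : IsOpen ({σ : absoluteGaloisGroup K | σ • ofTwist t = ofTwist t} ∩
      (κ.layerSubgroup (level hM (ofTwist t)) : Set (absoluteGaloisGroup K))) :=
    (hMo _).inter (κ.isOpen_layerSubgroup _)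
  refine Filter.mem_of_superset (hU.mem_nhds ⟨by simp, one_mem _⟩) ?_
  rintro σ ⟨h1σ, h2σ⟩
  change σ • t = t
  apply ofTwist.injective
  rw [ofTwist_smul_of_mem_layerSubgroup h2σ]
  exact h1σ

end UnitTwist

end ZpExtension

/-! ## §5. `H¹` along an equivariant isomorphism of coefficients; the twist of `conj` -/

section H1Transport

variable {G : Type u} [Group G] [TopologicalSpace G] [IsTopologicalGroup G]
variable {M T : Type u} [AddCommGroup M] [DistribMulAction G M] [TopologicalSpace M]
  [DiscreteTopology M] [AddCommGroup T] [DistribMulAction G T] [TopologicalSpace T]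
  [DiscreteTopology T]

omit [IsTopologicalGroup G] [TopologicalSpace M] [DiscreteTopology M] [TopologicalSpace T]
  [DiscreteTopology T] in
/-- The inverse of an `H`-equivariant additive isomorphism is `H`-equivariant (compatible pairs).
[cite: SerreGaloisCohomology1997, I §2.4] -/
theorem equivariant_symm_of_equivariant (H : Subgroup G) (e : T ≃+ M)
    (he : ∀ (x : H) (t : T), (e : T →+ M) (ContinuousMonoidHom.id H x • t) = x • (e : T →+ M) t)
    (x : H) (m : M) :
    (e.symm : M →+ T) (ContinuousMonoidHom.id H x • m) = x • (e.symm : M →+ T) m := by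
  apply e.injective
  have h := he x (e.symm m)
  simp only [AddMonoidHom.coe_coe, AddEquiv.apply_symm_apply] at h ⊢
  exact h.symm

/-- **`H¹(H, T) ≃ H¹(H, M)` along an `H`-equivariant additive isomorphism `e : T ≃ M` of coefficients**
(`resH1Hom (id_H, e)` with inverse `resH1Hom (id_H, e⁻¹)`). For `T = A(χ_u)`, `M = A`, `H ≤ ker κ` this is
Greenberg's `H¹(F_∞, A_s) = H¹(F_∞, A)`. [cite: GreenbergLNM1716, §4 p. 107]
[cite: SerreGaloisCohomology1997, I §2.4] -/
def subgroupH1Congr (H : Subgroup G) (e : T ≃+ M)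
    (he : ∀ (x : H) (t : T), (e : T →+ M) (ContinuousMonoidHom.id H x • t) = x • (e : T →+ M) t) :
    subgroupH1 H T ≃+ subgroupH1 H M :=
  AddMonoidHom.toAddEquiv (resH1Hom (ContinuousMonoidHom.id H) (e : T →+ M) he)
    (resH1Hom (ContinuousMonoidHom.id H) (e.symm : M →+ T) (equivariant_symm_of_equivariant H e he))
    (by
      rw [resH1Hom_comp, ← resH1Hom_id]
      exact resH1Hom_congr (ContinuousMonoidHom.ext fun _ ↦ rfl)
        (AddMonoidHom.ext fun t ↦ e.symm_apply_apply t) _ _)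
    (by
      rw [resH1Hom_comp, ← resH1Hom_id]
      exact resH1Hom_congr (ContinuousMonoidHom.ext fun _ ↦ rfl)
        (AddMonoidHom.ext fun m ↦ e.apply_symm_apply m) _ _)

/-- Unfolding `subgroupH1Congr`: it is `resH1Hom (id_H, e)`. [cite: SerreGaloisCohomology1997, I §2.4] -/
theorem subgroupH1Congr_apply (H : Subgroup G) (e : T ≃+ M)
    (he : ∀ (x : H) (t : T), (e : T →+ M) (ContinuousMonoidHom.id H x • t) = x • (e : T →+ M) t)
    (x : subgroupH1 H T) :
    subgroupH1Congr H e he x = resH1Hom (ContinuousMonoidHom.id H) (e : T →+ M) he x := rfl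

/-- `subgroupH1Congr` on an explicit cocycle: the class of `e ∘ ξ`. [cite: SerreGaloisCohomology1997, I §2.4] -/
theorem subgroupH1Congr_oneCocycleClass (H : Subgroup G) (e : T ≃+ M)
    (he : ∀ (x : H) (t : T), (e : T →+ M) (ContinuousMonoidHom.id H x • t) = x • (e : T →+ M) t)
    (ξ : contOneCocycles (discreteTopRep H T)) :
    subgroupH1Congr H e he (oneCocycleClass _ ξ) =
      oneCocycleClass _ (contOneCocycles.push (e : T →+ M) he ξ) :=
  resH1Hom_id_oneCocycleClass (e : T →+ M) he ξ

variable {p : ℕ}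

/-- **How `conj_σ` transforms**: if `σ` acts on `T` as `c_k · σ` acts on `M` on `p^k`-torsion elements
(`e (σ t) = c_k · σ e t` whenever `p^k t = 0`, for a compatible family of integers `c_k`), `T` is
`p`-primary and `H` is compact and normal, then for every class `x ∈ H¹(H, T)` killed by `p^k`,
`e_* (conj_σ x) = c_k · conj_σ (e_* x)` in `H¹(H, M)`. (A continuous cocycle on the compact `H` takes
finitely many values, all killed by one `p^L`; compare the cocycles at level `L`, then trade `c_L` for
`c_k`.) For `T = A(χ_u)`: `conj_σ` on `H¹(F_∞, A_s)` is `κ^s(σ) · conj_σ` on `H¹(F_∞, A)`.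
[cite: GreenbergLNM1716, §4 p. 107] [cite: SerreGaloisCohomology1997, I §5.3] -/
theorem subgroupH1Congr_conjH1_eq_zsmul (H : Subgroup G) [H.Normal] [CompactSpace H] (e : T ≃+ M)
    (he : ∀ (x : H) (t : T), (e : T →+ M) (ContinuousMonoidHom.id H x • t) = x • (e : T →+ M) t)
    (hT : IsPrimaryTorsion p T) (σ : G) (c : ℕ → ℤ)
    (hσ : ∀ (k : ℕ) (t : T), p ^ k • t = 0 → e (σ • t) = c k • (σ • e t))
    (hc : ∀ (k k' : ℕ) (y : subgroupH1 H M), p ^ k • y = 0 → p ^ k' • y = 0 → c k • y = c k' • y)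
    (x : subgroupH1 H T) {k : ℕ} (hk : p ^ k • x = 0) :
    subgroupH1Congr H e he (conjH1 H T σ x) = c k • conjH1 H M σ (subgroupH1Congr H e he x) := by
  obtain ⟨ξ, rfl⟩ := oneCocycleClass_surjective _ x
  -- a common killing exponent `L` for the finitely many values of `ξ`
  obtain ⟨L, hL⟩ := ZpExtension.exists_pow_nsmul_eq_zero_of_finite hT
    ((isCompact_range ξ.1.continuous).finite_of_discrete)
  have hLξ : ∀ n : H, p ^ L • ξ.1 n = 0 := fun n ↦ hL _ ⟨n, rfl⟩
  -- the class itself is killed by `p^L`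
  have hξ0 : p ^ L • ξ = 0 := by
    apply Subtype.ext; ext n
    change p ^ L • ξ.1 n = 0
    exact hLξ n
  have hLx : p ^ L • oneCocycleClass (discreteTopRep H T) ξ = 0 := by
    have h := map_nsmul (oneCocycleClassₗ (discreteTopRep H T)) (p ^ L) ξ
    rw [hξ0, map_zero] at h
    exact h.symm
  -- compare the cocycles at level `L`
  have key : contOneCocycles.push (e : T →+ M) he (conjCocycle H σ ξ) =
      c L • conjCocycle H σ (contOneCocycles.push (e : T →+ M) he ξ) := by
    apply Subtype.ext; ext n
    change (e : T →+ M) ((conjCocycle H σ ξ).1 n) =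
      c L • (conjCocycle H σ (contOneCocycles.push (e : T →+ M) he ξ)).1 n
    rw [conjCocycle_apply, conjCocycle_apply, contOneCocycles.push_apply, AddMonoidHom.coe_coe,
      hσ L _ (hLξ _), smul_comm]
  have hs : oneCocycleClass (discreteTopRep H M)
      (c L • conjCocycle H σ (contOneCocycles.push (e : T →+ M) he ξ)) =
      c L • oneCocycleClass _ (conjCocycle H σ (contOneCocycles.push (e : T →+ M) he ξ)) :=
    map_zsmul (oneCocycleClassₗ (discreteTopRep H M)) (c L) _
  rw [conjH1_oneCocycleClass, subgroupH1Congr_oneCocycleClass, subgroupH1Congr_oneCocycleClass, key,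
    hs, conjH1_oneCocycleClass]
  -- trade `c_L` for `c_k` on the class `y = conj_σ (e_* x)`
  refine hc L k _ ?_ ?_
  · rw [← conjH1_oneCocycleClass, ← subgroupH1Congr_oneCocycleClass, ← map_nsmul, ← map_nsmul, hLx,
      map_zero, map_zero]
  · rw [← conjH1_oneCocycleClass, ← subgroupH1Congr_oneCocycleClass, ← map_nsmul, ← map_nsmul, hk,
      map_zero, map_zero]

end H1Transport

end Literature.NumberTheory.EllipticCurves

end
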